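/-
COR-CM (cell pub-hodgecm2) — Δ2 BRIDGE, ADAPTER TRACK (c-S.2): [Liu21, Def. 4.12, last sentence] AT THE LEVEL OF INDEX SETS — the
`μ`-admissible collections read through `epsOf` are the `μᶜ`-admissible collections read through `epsOf ∘ (e ↦ −e)` (third file of seat
prover-pub-hodgecm2-d2bridge-adapt-3-g0-0, after ✔ `AdapterMuConjRelabel` p372597 and `AdapterMuConjEta` p372910).  THEOREMS ONLY; explicit binders;
nothing landed is edited or restated.  HC_CM is NOT proved; «Δ2 BRIDGE CLOSED» is NOT claimed; no pointer moves.
-/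
import Literature.NumberTheory.Automorphic.IdeleClassCharacterConjugate
import Literature.AlgebraicGeometry.Liu2021.AdmissibleElement
import HarnessLib

set_option autoImplicit false

/-!
# Δ2 adapter (c-S.2): the Thm 4.18 index set under `μ ↦ μᶜ`, `e ↦ −e`

[Liu2021] Def. 4.12 (TeX l. 2109): «It is clear by Remark 4.4 that `ε` is `μ`-admissible if and only if `−ε` is `μᶜ`-admissible.»  The tree
models the collection `ε` generated by `e ∈ E^{×−}` through a carrier map `epsOf : E → Eps` (`Thm418Data.epsOf`; in the cells' rests
`Def411WeilCarriers.epsOf … δ′`, the local classes of `e/δ′`), and «`ε` is `μ`-admissible» as `∃ e, IsAdmissibleElement E Φ_μ e ∧ epsOf e = ε`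
(`Thm418Data.IsAdmissible`).  Adapter seat 1's relabelled family `muConj` keeps `Eps`, `Chi` and puts `epsOf′ e := epsOf (−e)`, `Φ′ := Φ_{μᶜ} = Φ̄_μ`.
This file proves that the two admissibility predicates on `Eps` COINCIDE — so the index sets `AdmIndex = {(ε, χ) // IsAdmissible ε}` of the
`μ`-rest and of the relabelled `μᶜ`-rest are the same subtype of `Eps × Chi` (seat 1's `admIndexMuConjEquiv` is `Equiv.subtypeEquivRight` of it):

* `exists_isAdmissibleElement_bar_neg_iff` — for any CM type `Φ`, carrier `epsOf` and label `ε`: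
  `(∃ e, IsAdmissibleElement E Φ̄ e ∧ epsOf (−e) = ε) ↔ (∃ e, IsAdmissibleElement E Φ e ∧ epsOf e = ε)` (witness `e ↦ −e`,
  `isAdmissibleElement_conj_neg_iff`);
* `exists_isAdmissibleElement_cmType_galConj_neg_iff` — the same with `Φ̄ := Φ_{μᶜ}` (`IsConjugateSymplectic.cmType_galConj`);
* `isAdmissibleElement_cmType_galConj_neg_iff` — element level: `−e` is `μᶜ`-admissible iff `e` is `μ`-admissible.

References: [Liu2021] Y. Liu, Camb. J. Math. 9 (2021) = arXiv:2102.11518, Def. 4.12 (ll. 2102–2109), Remark 4.4 (ll. 1930–1933), Thm. 4.18 (l. 2237).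
-/

noncomputable section

namespace Summit.HodgeConjecture.CorCM.D2Bridge.AdapterRelabel

open NumberField NumberField.ComplexEmbedding
open Literature.AlgebraicGeometry.Motives (CMType)
open Literature.AlgebraicGeometry.Liu2021 (IsAdmissibleElement isAdmissibleElement_conj_neg_iff)
open Literature.NumberTheory.ComplexMultiplication
open Literature.NumberTheory.ComplexMultiplication.CMTypeOps (bar coe_bar_eq_setOf_conjugate_mem)
open Literature.NumberTheory.Automorphic Literature.NumberTheory.Automorphic.IdeleClassGroup

section Index

variable {E : Type} [Field E] [NumberField E] [IsCMField E]

/-- **Element level: `−e` is admissible for `Φ̄` iff `e` is admissible for `Φ`** (the tree's `isAdmissibleElement_conj_neg_iff`, with its index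
set `{τ′ | τ̄′ ∈ Φ}` identified with `(bar Φ).1`). [cite: Liu2021, Def. 4.12 (TeX ll. 2102–2109)] -/
theorem isAdmissibleElement_bar_neg_iff (Φ : CMType E) (e : E) :
    IsAdmissibleElement E (bar Φ).1 (-e) ↔ IsAdmissibleElement E Φ.1 e := by
  rw [coe_bar_eq_setOf_conjugate_mem, isAdmissibleElement_conj_neg_iff]

/-- **Element level for `μᶜ`: `−e` is `μᶜ`-admissible iff `e` is `μ`-admissible** (`Φ_{μᶜ} = Φ̄_μ`).
[cite: Liu2021, Def. 4.12 (TeX ll. 2102–2109) and Remark 4.4 (ll. 1930–1933)] -/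
theorem isAdmissibleElement_cmType_galConj_neg_iff {μ : Literature.NumberTheory.Automorphic.IdeleClassGroup E →ₜ* Circle}
    (hμ : IsConjugateSymplectic E μ) (e : E) :
    IsAdmissibleElement E hμ.galConj.cmType.1 (-e) ↔ IsAdmissibleElement E hμ.cmType.1 e := by
  rw [hμ.cmType_galConj, isAdmissibleElement_bar_neg_iff]

/-- **[Liu21, Def. 4.12, last sentence] on index sets**: for any CM type `Φ`, carrier `epsOf : E → Eps` and label `ε`, «`ε` is admissible for
`Φ̄` through `epsOf ∘ (e ↦ −e)`» iff «`ε` is admissible for `Φ` through `epsOf`» — the witness is `e ↦ −e` both ways.  Hence the index set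
`{(ε, χ) // ∃ e, adm_{Φ̄}(e) ∧ epsOf (−e) = ε}` of the relabelled family IS the index set of the original one.
[cite: Liu2021, Def. 4.12 (TeX ll. 2102–2109), Thm. 4.18 (l. 2237)] -/
theorem exists_isAdmissibleElement_bar_neg_iff (Φ : CMType E) {Eps : Type} (epsOf : E → Eps) (ε : Eps) :
    (∃ e : E, IsAdmissibleElement E (bar Φ).1 e ∧ epsOf (-e) = ε) ↔ (∃ e : E, IsAdmissibleElement E Φ.1 e ∧ epsOf e = ε) := by
  constructor
  · rintro ⟨e, he, hε⟩
    exact ⟨-e, (isAdmissibleElement_bar_neg_iff Φ (-e)).1 (by rwa [neg_neg]), hε⟩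
  · rintro ⟨e, he, hε⟩
    exact ⟨-e, (isAdmissibleElement_bar_neg_iff Φ e).2 he, by rwa [neg_neg]⟩

/-- **The `μᶜ` form**: «`ε` is `μᶜ`-admissible through `epsOf ∘ (e ↦ −e)`» iff «`ε` is `μ`-admissible through `epsOf`» — the `IsAdmissible`
clause of adapter seat 1's relabelled rest `muConj` at `ν = μᶜ` equals that of the `μ`-rest, label by label.
[cite: Liu2021, Def. 4.12 (TeX ll. 2102–2109) and Remark 4.4 (ll. 1930–1933)] -/
theorem exists_isAdmissibleElement_cmType_galConj_neg_iff {μ : Literature.NumberTheory.Automorphic.IdeleClassGroup E →ₜ* Circle}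
    (hμ : IsConjugateSymplectic E μ) {Eps : Type} (epsOf : E → Eps) (ε : Eps) :
    (∃ e : E, IsAdmissibleElement E hμ.galConj.cmType.1 e ∧ epsOf (-e) = ε) ↔
      (∃ e : E, IsAdmissibleElement E hμ.cmType.1 e ∧ epsOf e = ε) := by
  rw [hμ.cmType_galConj, exists_isAdmissibleElement_bar_neg_iff]

/-- The same read from `μᶜ` back to `μ` with the carrier already composed with negation on the `μ` side (`(μᶜ)ᶜ = μ` bookkeeping for seat 1's
cast): «`ε` is `μ`-admissible through `epsOf ∘ (e ↦ −e)`» iff «`ε` is `μᶜ`-admissible through `epsOf`». [cite: Liu2021, Def. 4.12 (TeX ll. 2102–2109)] -/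
theorem exists_isAdmissibleElement_cmType_neg_iff_galConj {μ : Literature.NumberTheory.Automorphic.IdeleClassGroup E →ₜ* Circle}
    (hμ : IsConjugateSymplectic E μ) {Eps : Type} (epsOf : E → Eps) (ε : Eps) :
    (∃ e : E, IsAdmissibleElement E hμ.cmType.1 e ∧ epsOf (-e) = ε) ↔
      (∃ e : E, IsAdmissibleElement E hμ.galConj.cmType.1 e ∧ epsOf e = ε) := by
  have h := exists_isAdmissibleElement_cmType_galConj_neg_iff hμ (fun e => epsOf (-e)) ε
  simp only [neg_neg] at h
  exact h.symm

end Index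

end Summit.HodgeConjecture.CorCM.D2Bridge.AdapterRelabel

end
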